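import Mathlib
import HarnessLib
import Summits.NavierStokesRegularity.NavierStokesRegularity.Theorems.PoloidalWindowDoorLrcModEntireTwistingTHSlopeFunction
import Summits.NavierStokesRegularity.NavierStokesRegularity.Theorems.PoloidalWindowDoorLrcModEntireTwistingTHNonflatPlane
import Summits.NavierStokesRegularity.NavierStokesRegularity.Theorems.PoloidalWindowDoorLrcModEntireRidgeWiring
import Summits.NavierStokesRegularity.NavierStokesRegularity.Theorems.PoloidalWindowDoorLrcModEntireTwistingTHHotPointPins
import Summits.NavierStokesRegularity.NavierStokesRegularity.Theorems.PoloidalWindowDoorPoloidalWindowRigidityTimeHeightShearLinearSlice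
import Summits.NavierStokesRegularity.NavierStokesRegularity.Theorems.PoloidalWindowDoorPoloidalWindowRigidityConstantShearSlice

/-!
# Item `LrcModEntire` (stmt-NavierStokesRegularity-20428) — THE FLAT RIDGE SUB-CELL (T2b-flat): at a flat hot point the whole Hessian of `v₂(−1,·)` vanishes

LEAD of item 20428 ns-poloidal-K2-p3 g15 (`--supports stmt-NavierStokesRegularity-20428 --as helper`).  Memo `Cruxes/LrcModEntire/T2B-g14.md` §13c / T2B-g15 §15e: the dichotomy of
`…TwistingTHRidgeLawNested.exists_ridgeLaw_nested` is `κ > 0` (non-degenerate ridge ⇒ BRANCH-PARAM ⇒ cell (Q4)) or `κ = 0` (FLAT ridge).  This file types the entrance of the flat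
branch, from clauses of `stub_T2b` VERBATIM (class, poloidality, global (TH), hot-spot normalisation, «empty planar interior»): if `D²(σv₂(−1,·))(y)[e₀,e₀] + [e₁,e₁] = 0` at a hot
point `y ∈ P₀`, then **the full `3 × 3` Hessian `D²(σv₂(−1,·))(y)` is zero** — `σv₂(−1,·) − |N|` vanishes to third order at `y`.  Proof: the Hessian is negative semi-definite at
every hot point (3-D maximum; `…ThreadPressure.threadHessianPin` transported by `…HotPointPins.hotNormalisation_translate` / `…FlatSlicePressure.class_comp_add_right`), a negative
semi-definite form with `Q(e₀) + Q(e₁) = 0` kills `e₀, e₁` (`bilin_apply_eq_zero_of_nonpos`), and the vertical entry is `∂₂²v₂ = −μ₀ Δₕv₂ = 0` by the plane-wave identity of the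
(TH) column (`…TimeHeightShearLinearSlice.plane_wave_identity`, slope on `P₀` from `…TwistingTHSlopeFunction.exists_slopeFunction_near_plane` under properness).

* `bilin_apply_eq_zero_of_nonpos` — `B` symmetric, `B(w,w) ≤ 0 ∀ w`, `B(e,e) = 0 ⇒ B(e,·) = 0`;
* `hessian_eq_zero_of_flatHotPoint` — the statement above.

WHAT THIS IS NOT: not a claim about Navier–Stokes regularity and not a proof of `stub_T2b`; the flat sub-cell stays OPEN (bears_on LADDER-NS N0, item 20428 / crux 19708; OPEN).
-/

set_option linter.style.longLine false
set_option linter.dupNamespace false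

namespace Summit.NavierStokesRegularity.NavierStokesRegularity.Theorems.PoloidalWindowDoorLrcModEntireTwistingTHFlatRidgeJet

open Set Function Filter Topology Metric
open scoped RealInnerProductSpace InnerProductSpace ContDiff Laplacian
open Literature.Analysis Literature.Analysis.FluidPDE Literature.Analysis.UnboundedOperators
open Summit.NavierStokesRegularity.NavierStokesRegularity.Theorems
open Summit.NavierStokesRegularity.NavierStokesRegularity.Theorems.LocalSineTubeDoorProfileAlignedWindowRigidityAncient
open Summit.NavierStokesRegularity.NavierStokesRegularity.Theorems.PoloidalWindowDoorLrcModEntireTwistingTHSlopeFunction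
open Summit.NavierStokesRegularity.NavierStokesRegularity.Theorems.PoloidalWindowDoorLrcModEntireTwistingTHNonflatPlane
open Summit.NavierStokesRegularity.NavierStokesRegularity.Theorems.PoloidalWindowDoorLrcModEntireRidgeWiring
open Summit.NavierStokesRegularity.NavierStokesRegularity.Theorems.PoloidalWindowDoorLrcModEntireThreadPressure
open Summit.NavierStokesRegularity.NavierStokesRegularity.Theorems.PoloidalWindowDoorLrcModEntireTwistingTHHotPointPins
open Summit.NavierStokesRegularity.NavierStokesRegularity.Theorems.PoloidalWindowDoorLrcModEntireTwistingTHFlatSlicePressure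
open Summit.NavierStokesRegularity.NavierStokesRegularity.Theorems.PoloidalWindowDoorPoloidalWindowRigidityTimeHeightShearLinearSlice
open Summit.NavierStokesRegularity.NavierStokesRegularity.Theorems.PoloidalWindowDoorPoloidalWindowRigidityConstantShearSlice

/-- A symmetric negative semi-definite bilinear form that vanishes on `(e,e)` has `e` in its kernel. -/
theorem bilin_apply_eq_zero_of_nonpos {E : Type*} [NormedAddCommGroup E] [NormedSpace ℝ E] (B : E →L[ℝ] E →L[ℝ] ℝ)
    (hsym : ∀ u w, B u w = B w u) (hneg : ∀ w, B w w ≤ 0) {e : E} (he : B e e = 0) (w : E) : B e w = 0 := by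
  set a := B e w with ha
  set b := B w w with hb
  have hq : ∀ t : ℝ, 2 * t * a + t ^ 2 * b ≤ 0 := fun t => by
    have h := hneg (e + t • w)
    simp only [map_add, map_smul, add_apply, smul_apply, smul_eq_mul] at h
    rw [he, hsym w e] at h
    nlinarith [h]
  have hb0 : b ≤ 0 := hneg w
  have h := hq (a / (|b| + 1))
  have hpos : 0 < |b| + 1 := by positivity
  have hkey : a ^ 2 * (2 * (|b| + 1) + b) ≤ 0 := by
    have h' := mul_nonpos_of_nonpos_of_nonneg h (le_of_lt (pow_pos hpos 2))
    have e1 : (2 * (a / (|b| + 1)) * a + (a / (|b| + 1)) ^ 2 * b) * (|b| + 1) ^ 2 = a ^ 2 * (2 * (|b| + 1) + b) := by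
      field_simp
    rwa [e1] at h'
  have hc : 0 < 2 * (|b| + 1) + b := by
    have : -|b| ≤ b := neg_abs_le b
    linarith [abs_nonneg b]
  have ha2 : a ^ 2 ≤ 0 := by
    by_contra hh
    push Not at hh
    have := mul_pos hh hc
    linarith
  exact pow_eq_zero_iff (n := 2) two_ne_zero |>.1 (le_antisymm ha2 (sq_nonneg a))

variable {C : ℝ} {v : ℝ → EuclideanSpace ℝ (Fin 3) → EuclideanSpace ℝ (Fin 3)}

/-- **AT A FLAT HOT POINT THE WHOLE HESSIAN OF `σv₂(−1,·)` VANISHES.**  See the module docstring. -/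
theorem hessian_eq_zero_of_flatHotPoint (hdec : HasTypeITimeDecay C v) (hcont : ContinuousOn (uncurry v) (Iio (0 : ℝ) ×ˢ univ))
    (hmild : ∀ s t : ℝ, s < t → t < 0 → ∀ x, v t x = heatExtension (v s) (t - s) x - oseenDuhamel 1 s v v t x)
    (hdiv : ∀ t < 0, VectorCalculus.IsDivFree (v t))
    (hTH : ∀ t < 0, ∀ x x' : EuclideanSpace ℝ (Fin 3), x 2 = x' 2 → ∀ b c : Fin 3, b ≠ 2 → c ≠ 2 →
      fderiv ℝ (v t) x (EuclideanSpace.single 2 1) b * fderiv ℝ (v t) x' (EuclideanSpace.single c 1) 2 =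
        fderiv ℝ (v t) x' (EuclideanSpace.single 2 1) c * fderiv ℝ (v t) x (EuclideanSpace.single b 1) 2)
    (hne : v (-1) 0 2 ≠ 0) (hhot : ∀ t < 0, ∀ x, Real.sqrt (-t) * |v t x 2| ≤ |v (-1) 0 2|)
    (hproper : ∀ y ∈ {y : EuclideanSpace ℝ (Fin 3) | y 2 = 0 ∧ v (-1) y 2 = v (-1) 0 2}, ∀ r : ℝ, 0 < r →
      ∃ y' : EuclideanSpace ℝ (Fin 3), y' 2 = 0 ∧ dist y' y < r ∧ v (-1) y' 2 ≠ v (-1) 0 2)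
    {σ : ℝ} (hσN : σ * v (-1) 0 2 = |v (-1) 0 2|)
    {y : EuclideanSpace ℝ (Fin 3)} (hy0 : y 2 = 0) (hy : v (-1) y 2 = v (-1) 0 2)
    (hflat : fderiv ℝ (fderiv ℝ (fun x => σ * v (-1) x 2)) y (EuclideanSpace.single 0 1) (EuclideanSpace.single 0 1) +
      fderiv ℝ (fderiv ℝ (fun x => σ * v (-1) x 2)) y (EuclideanSpace.single 1 1) (EuclideanSpace.single 1 1) = 0) :
    ∀ u w : EuclideanSpace ℝ (Fin 3), fderiv ℝ (fderiv ℝ (fun x => σ * v (-1) x 2)) y u w = 0 := by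
  have h1 : (-1 : ℝ) < 0 := by norm_num
  have hσ0 : σ ≠ 0 := by
    intro h; rw [h, zero_mul] at hσN; exact (abs_pos.2 hne).ne' hσN.symm |>.elim
  -- slice regularity and the two currencies
  have hslice_an : AnalyticOnNhd ℝ (v (-1)) univ := analyticOnNhd_slice hcont (bdd_of_hasTypeITimeDecay hdec) hmild h1
  have hslice : ContDiff ℝ ∞ (v (-1)) := contDiffOn_univ.1 hslice_an.contDiffOn_of_completeSpace
  set θ : EuclideanSpace ℝ (Fin 3) → ℝ := fun x => v (-1) x 2 with hθdef
  set f : EuclideanSpace ℝ (Fin 3) → ℝ := fun x => σ * v (-1) x 2 with hfdef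
  have hθan : AnalyticOnNhd ℝ θ univ := fun x hx => ((EuclideanSpace.proj (𝕜 := ℝ) (2 : Fin 3)).analyticAt _).comp (hslice_an x hx)
  have hθ : ContDiff ℝ 2 θ := hθan.contDiff.of_le le_top
  have hfθ : f = σ • θ := by funext x; simp [hfdef, hθdef, smul_eq_mul]
  have hf : ContDiff ℝ 2 f := by rw [hfθ]; exact hθ.const_smul σ
  have hD2 : ∀ x u w, fderiv ℝ (fderiv ℝ f) x u w = σ * fderiv ℝ (fun x' => fderiv ℝ θ x' w) x u := by
    intro x u w
    rw [fderiv_fderiv_eq_coord hf]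
    have e1 : (fun x' => fderiv ℝ f x' w) = fun x' => σ * fderiv ℝ θ x' w := by
      funext x'
      rw [hfθ, fderiv_const_smul ((hθ.differentiable (by norm_num)) x') σ]
      simp [smul_eq_mul]
    rw [e1]
    have hdw : DifferentiableAt ℝ (fun x' => fderiv ℝ θ x' w) x :=
      (((hθ.fderiv_right (m := 1) (by norm_num)).differentiable one_ne_zero).clm_apply (differentiable_const w)) x
    rw [show (fun x' => σ * fderiv ℝ θ x' w) = σ • (fun x' => fderiv ℝ θ x' w) by funext x'; simp [smul_eq_mul], fderiv_const_smul hdw σ]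
    simp [smul_eq_mul]
  set B := fderiv ℝ (fderiv ℝ f) y with hB
  have hsym : ∀ u w, B u w = B w u := fun u w => (hf.contDiffAt (x := y)).isSymmSndFDerivAt (by simp) u w
  -- ## the Hessian is negative semi-definite at the hot point `y` (translated Hessian pin)
  have hneg : ∀ w, B w w ≤ 0 := by
    intro w
    obtain ⟨hrate', hcont', hmild', -⟩ := class_comp_add_right hdec hcont hmild hdiv y
    obtain ⟨hne', hhot'⟩ := hotNormalisation_translate hne hhot hy
    have hpin := threadHessianPin hrate' hcont' hmild' hne' hhot' w
    -- translate back: `D²(v₂(−1, · + y))(0) = D²v₂(−1,·)(y)`, value `v₂(−1, 0 + y) = N`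
    have e0 : (fun t w' => v t (w' + y)) (-1) 0 2 = v (-1) 0 2 := by
      show v (-1) (0 + y) 2 = v (-1) 0 2
      rw [zero_add]; exact hy
    have e2 : (fun w' => (fun t w' => v t (w' + y)) (-1) w' 2) = fun w' : EuclideanSpace ℝ (Fin 3) => θ (w' + y) := rfl
    rw [e0, e2, iteratedFDeriv_comp_add_right (f := θ) 2 y 0, zero_add, iteratedFDeriv_two_apply] at hpin
    simp only [Matrix.cons_val_zero, Matrix.cons_val_one] at hpin
    -- `N · D²θ(y)[w,w] ≤ 0`, `σN = |N| > 0` ⇒ `σ D²θ(y)[w,w] ≤ 0`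
    have hσθ : B w w = σ * fderiv ℝ (fderiv ℝ θ) y w w := by rw [hB, hD2, ← fderiv_fderiv_eq_coord hθ]
    rw [hσθ]
    have hkey : σ * fderiv ℝ (fderiv ℝ θ) y w w * |v (-1) 0 2| ≤ 0 := by
      rw [← hσN]
      have : σ * fderiv ℝ (fderiv ℝ θ) y w w * (σ * v (-1) 0 2) = σ ^ 2 * (v (-1) 0 2 * fderiv ℝ (fderiv ℝ θ) y w w) := by ring
      rw [this]
      exact mul_nonpos_of_nonneg_of_nonpos (sq_nonneg σ) hpin
    by_contra hcon
    push Not at hcon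
    have := mul_pos hcon (abs_pos.2 hne)
    linarith
  -- ## the horizontal directions are in the kernel
  have h00 : B (EuclideanSpace.single 0 1) (EuclideanSpace.single 0 1) = 0 := by
    have := hneg (EuclideanSpace.single 0 1); have := hneg (EuclideanSpace.single 1 1); rw [hB] at *; linarith
  have h11 : B (EuclideanSpace.single 1 1) (EuclideanSpace.single 1 1) = 0 := by
    have := hneg (EuclideanSpace.single 0 1); rw [hB] at *; linarith
  have hk0 : ∀ w, B (EuclideanSpace.single 0 1) w = 0 := bilin_apply_eq_zero_of_nonpos B hsym hneg h00
  have hk1 : ∀ w, B (EuclideanSpace.single 1 1) w = 0 := bilin_apply_eq_zero_of_nonpos B hsym hneg h11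
  -- ## the vertical entry: plane-wave identity `∂₂²θ = −μ₀ Δₕθ` on `P₀`
  have h02 : (0 : EuclideanSpace ℝ (Fin 3)) 2 = 0 := rfl
  obtain ⟨y', hy'2, -, hy'ne⟩ := hproper 0 ⟨h02, rfl⟩ 1 one_pos
  obtain ⟨y₁, hy₁, c₁, hc₁, hne₁⟩ := exists_fderiv_two_ne_zero_of_properRidge (hslice.differentiable (by simp)) ⟨y', hy'2, hy'ne⟩
  obtain ⟨μ, -, hslope, -⟩ := exists_slopeFunction_near_plane hdec hcont hmild hTH hy₁ hc₁ hne₁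
  have hslope0 : ∀ w : EuclideanSpace ℝ (Fin 3), w 2 = 0 → ∀ b : Fin 3, b ≠ 2 →
      fderiv ℝ (v (-1)) w (EuclideanSpace.single 2 (1 : ℝ)) b = μ (-1) 0 * fderiv ℝ (v (-1)) w (EuclideanSpace.single b (1 : ℝ)) 2 := by
    intro w hw b hb
    have h := (hslope w hw).self_of_nhds b hb
    simpa [hw] using h
  have hdivpt : ∀ x : EuclideanSpace ℝ (Fin 3), fderiv ℝ (v (-1)) x (EuclideanSpace.single 0 (1 : ℝ)) 0 +
      fderiv ℝ (v (-1)) x (EuclideanSpace.single 1 (1 : ℝ)) 1 + fderiv ℝ (v (-1)) x (EuclideanSpace.single 2 (1 : ℝ)) 2 = 0 :=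
    fun x => div_coord (hdiv (-1) h1) x
  have hpw := plane_wave_identity (hslice.of_le (by exact WithTop.coe_le_coe.2 le_top)) hdivpt hslope0 hy0
  have h22 : B (EuclideanSpace.single 2 1) (EuclideanSpace.single 2 1) = 0 := by
    have hsum : fderiv ℝ (fun w => fderiv ℝ θ w (EuclideanSpace.single 0 (1 : ℝ))) y (EuclideanSpace.single 0 (1 : ℝ)) +
        fderiv ℝ (fun w => fderiv ℝ θ w (EuclideanSpace.single 1 (1 : ℝ))) y (EuclideanSpace.single 1 (1 : ℝ)) = 0 := by
      have h := hflat
      rw [hD2, hD2] at h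
      have : σ * (fderiv ℝ (fun w => fderiv ℝ θ w (EuclideanSpace.single 0 (1 : ℝ))) y (EuclideanSpace.single 0 (1 : ℝ)) +
          fderiv ℝ (fun w => fderiv ℝ θ w (EuclideanSpace.single 1 (1 : ℝ))) y (EuclideanSpace.single 1 (1 : ℝ))) = 0 := by linarith
      exact (mul_eq_zero.1 this).resolve_left hσ0
    rw [hB, hD2]
    simp only [hθdef] at hpw hsum ⊢
    rw [hpw, hsum, mul_zero, mul_zero]
  have hk2 : ∀ w, B (EuclideanSpace.single 2 1) w = 0 := bilin_apply_eq_zero_of_nonpos B hsym hneg h22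
  -- ## conclusion by bilinearity
  intro u w
  have hu : u = u 0 • EuclideanSpace.single 0 (1 : ℝ) + u 1 • EuclideanSpace.single 1 (1 : ℝ) + u 2 • EuclideanSpace.single 2 (1 : ℝ) := by
    ext i; fin_cases i <;> simp
  rw [hu]
  simp only [map_add, map_smul, add_apply, smul_apply, smul_eq_mul, hk0, hk1, hk2, mul_zero, add_zero]

end Summit.NavierStokesRegularity.NavierStokesRegularity.Theorems.PoloidalWindowDoorLrcModEntireTwistingTHFlatRidgeJet
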